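import Summits.Ventures.HSemireg.WedgeWeilPurityGens
import Summits.Ventures.HSemireg.WedgeBoxPurityRank
import Summits.Ventures.HSemireg.WedgeWeilOneSided

/-!
# Venture HSemireg — the Weil-frame purity locus (2/3): the change of generators Φ and the rank transport

HONEST FRAMING. Part of the Lean index of the computation cell `pub-hsemireg` (second enclosure wave, cut by seat p6 in the
conventions of seat p3's ENCLOSURE-PLAN-p3.md / build.py from th-7's kernel assets).  Finite-dimensional exterior algebra over a field ONLY:
no variety, no cohomology theory, no semiregularity map is constructed here; nothing here says that HC / HC_CM / HC_AV holds;
no Literature fact is declared or used.  The geometric DICTIONARY (why these ranks are the `HT`-side box ranks of the cell's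
STRUCTURE.md §1 / theory/FORMULA-N.md) lives in theory/FORMULA-N-th7.md PART B §A.3 / §N and is NOT asserted in Lean.

th-7's PART W — THE WEIL-FRAME PURITY LOCUS: transport of PART V (`WedgeBoxPurityRank.lean`) to WeilRank's model (theory/th7/WeilPurity.lean v3.2 sha256/16 fa4f1543e639b652 (th-7 g5, 22:21Z 2026-08-22; ×2 farm rc 0 + axioms standard at p3 g9 21:58Z (v3.1 prefix), th-2 g22 22:27Z, p6 g7 22:32Z; statement reads + independent exact numerics p6 g6 X2-WEILPURITY-p6g6.md a0873432c5a1b400 (PART W 105/105, PART D 704/704) and p6 g7 X2-WEILPURITY-E-p6g7.md 6348f244af71037e (PART E 216/216)),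
l.6119–6384), VERBATIM up to namespaces (`HSemiregWeilPurity` ↦ `Summit.Ventures.HSemireg.Wedge.WeilPurity`, which sees `….Wedge` and opens `….Wedge.Hankel`
HIDING the th-6-glue names `Φ` / `isoQ` / `Φ_ι` of `WedgeHankelGlue.lean` — PART W's own `Φ` / `isoQ` / `Φ_ι` (the change of generators below) keep th-7's
printed names; `HSemiregBox.` ↦ `Summit.Ventures.HSemireg.WedgeBox.`, `HSemiregWeil` ↦ `….Wedge.Weil`), file 2 of 3.
MODEL / THEOREM (file 3, `weilPurity`, `weilPurity_vW`): in the wedge model of Weil type `(n,n)` (`N = n + n` pairs `x_c, y_c`; h-part `w_N(q)`) with the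
two-exponential h-part `q_k = c₁λ^k + c₂μ^k` (`λ ≠ μ`) and `v = w_N(q) + a·Π_{c≥n}(x_c∧y_c) + b·Π_{c<n}(x_c∧y_c)` (resp. WeilRank's own
`vW = w_N(q) + a·E_{Gm} + b·E_{Dm}`), `c₁c₂ab ≠ 0`, every field, every `n ≥ 1`: `rank(θ ↦ θ ∧ v ∣ ⋀ⁿ) + 4 + 2·[ab = c₁c₂(λ−μ)^{2n}] = 4·C(2n,n)`
(FORMULA-N PART B §L.5, STRUCTURE C16; `n = 2`: `18 ∣ 20`, T4a's (I2-β)).  Route: the change of generators `A0 = (x_c+λy_c)_{c≥n}`, `A1 = (x_c+μy_c)_{c<n}`,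
`C0 = (x_c+λy_c)_{c<n}`, `C1 = (x_c+μy_c)_{c≥n}` is a linear equivalence; the induced isomorphism of exterior algebras carries PART V's `hbox c`
(`c₀₀ = (−1)^{n·n}c₁`, `c₁₁ = c₂`, `c₀₁ = a/((−1)^{C(n,2)}(μ−λ)ⁿ)`, `c₁₀ = b/((−1)^{C(n,2)}(λ−μ)ⁿ)`) to `v` and `⋀ⁿ` to `⋀ⁿ`, and `det c = 0 ⟺ ab = c₁c₂(λ−μ)^{2n}`.
Sign-free (parities only).  This file: `List.ofFn`-products, a box block as the ordered product of its generators (`B_A0_eq` …), the adapted generators `img` and the change-of-generators map `ψ` (a linear equivalence `ψE` when `λ ≠ μ`), the algebra isomorphism **`Φ`** (`isoQ`, `Φ_ι`), and the rank transport `finrank_range_wedge_Φ`.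
-/

/-! ### PART W, continued: the change of generators and the transport of PART V -/

namespace Summit.Ventures.HSemireg.Wedge.WeilPurity

open Module Set Set.powersetCard Summit.Ventures.HSemireg.Wedge.Weil
open Summit.Ventures.HSemireg.Wedge.Hankel hiding Φ isoQ Φ_ι

variable (K : Type*) [Field K] (n : ℕ)

/-! #### Products of linear elements as `List.ofFn`-products -/

variable {n} in
/-- the ordered product `gq t s m` as a `List.ofFn` product of its linear factors. -/
lemma gq_eq_ofFn (t : K) (s : ℕ) : ∀ m : ℕ,
    gq K n t s m = (List.ofFn fun j : Fin m => X K (n + n) (s + j) + t • Y K (n + n) (s + j)).prod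
  | 0 => by rw [gq, List.ofFn_zero, List.prod_nil]
  | m + 1 => by
    rw [gq, gq_eq_ofFn t s m, List.ofFn_succ', List.concat_eq_append, List.prod_append, List.prod_singleton,
      Fin.val_last]
    rfl

/-! #### Box side: a block is the ordered product of its generators -/

/-- the `j`-th generator index of the interval block starting at `off`. -/
def eoff (off : ℕ) (h : off + n ≤ n + n + n + n) (j : Fin n) : Summit.Ventures.HSemireg.WedgeBox.I n :=
  ⟨off + j, by have := j.2; omega⟩

variable {n}

/-- the offset enumeration of an interval block is strictly monotone. -/
lemma eoff_strictMono (off : ℕ) (h : off + n ≤ n + n + n + n) : StrictMono (eoff n off h) := by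
  intro a b hab
  show (⟨off + a, _⟩ : Fin _) < ⟨off + b, _⟩
  rw [Fin.mk_lt_mk]
  exact Nat.add_lt_add_left hab off

/-- a block containing the `n` consecutive indices from `off` is their ordered product. -/
lemma B_eq_prod_eoff (s : powersetCard (Summit.Ventures.HSemireg.WedgeBox.I n) n) (off : ℕ) (h : off + n ≤ n + n + n + n)
    (hmem : ∀ j, eoff n off h j ∈ (s : Finset (Summit.Ventures.HSemireg.WedgeBox.I n))) :
    Summit.Ventures.HSemireg.WedgeBox.B K n s =
      (List.ofFn fun j : Fin n => ExteriorAlgebra.ι K (Summit.Ventures.HSemireg.WedgeBox.b K n (eoff n off h j))).prod := by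
  have he : ⇑(ofFinEmbEquiv.symm s) = eoff n off h := by
    rw [ofFinEmbEquiv_symm_apply]
    exact (Finset.orderEmbOfFin_unique _ hmem (eoff_strictMono off h)).symm
  rw [Summit.Ventures.HSemireg.WedgeBox.B_eq_ιprod, List.map_ofFn, he]
  rfl

/-- the box monomial `E_{A 0}` is the ordered product of its generators. -/
lemma B_A0_eq : Summit.Ventures.HSemireg.WedgeBox.B K n (Summit.Ventures.HSemireg.WedgeBox.Apc n 0 : powersetCard (Summit.Ventures.HSemireg.WedgeBox.I n) n) =
    (List.ofFn fun j : Fin n =>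
      ExteriorAlgebra.ι K (Summit.Ventures.HSemireg.WedgeBox.b K n (eoff n 0 (by omega) j))).prod := by
  refine B_eq_prod_eoff K _ 0 (by omega) fun j => ?_
  show eoff n 0 _ j ∈ Summit.Ventures.HSemireg.WedgeBox.A n 0
  have hj := j.2
  rw [Summit.Ventures.HSemireg.WedgeBox.mem_A]
  simp only [eoff, Fin.val_mk, Fin.isValue, Fin.val_zero]
  all_goals omega

/-- the box monomial `E_{A 1}` is the ordered product of its generators. -/
lemma B_A1_eq : Summit.Ventures.HSemireg.WedgeBox.B K n (Summit.Ventures.HSemireg.WedgeBox.Apc n 1 : powersetCard (Summit.Ventures.HSemireg.WedgeBox.I n) n) =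
    (List.ofFn fun j : Fin n =>
      ExteriorAlgebra.ι K (Summit.Ventures.HSemireg.WedgeBox.b K n (eoff n n (by omega) j))).prod := by
  refine B_eq_prod_eoff K _ n (by omega) fun j => ?_
  show eoff n n _ j ∈ Summit.Ventures.HSemireg.WedgeBox.A n 1
  have hj := j.2
  rw [Summit.Ventures.HSemireg.WedgeBox.mem_A]
  simp only [eoff, Fin.val_mk, Fin.isValue, Fin.val_one]
  all_goals omega

/-- the box monomial `E_{C 0}` is the ordered product of its generators. -/
lemma B_C0_eq : Summit.Ventures.HSemireg.WedgeBox.B K n (Summit.Ventures.HSemireg.WedgeBox.Cpc n 0 : powersetCard (Summit.Ventures.HSemireg.WedgeBox.I n) n) =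
    (List.ofFn fun j : Fin n =>
      ExteriorAlgebra.ι K (Summit.Ventures.HSemireg.WedgeBox.b K n (eoff n (n + n) (by omega) j))).prod := by
  refine B_eq_prod_eoff K _ (n + n) (by omega) fun j => ?_
  show eoff n (n + n) _ j ∈ Summit.Ventures.HSemireg.WedgeBox.C n 0
  have hj := j.2
  rw [Summit.Ventures.HSemireg.WedgeBox.mem_C]
  simp only [eoff, Fin.val_mk, Fin.isValue, Fin.val_zero]
  all_goals omega

/-- the box monomial `E_{C 1}` is the ordered product of its generators. -/
lemma B_C1_eq : Summit.Ventures.HSemireg.WedgeBox.B K n (Summit.Ventures.HSemireg.WedgeBox.Cpc n 1 : powersetCard (Summit.Ventures.HSemireg.WedgeBox.I n) n) =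
    (List.ofFn fun j : Fin n =>
      ExteriorAlgebra.ι K (Summit.Ventures.HSemireg.WedgeBox.b K n (eoff n (n + n + n) (by omega) j))).prod := by
  refine B_eq_prod_eoff K _ (n + n + n) (by omega) fun j => ?_
  show eoff n (n + n + n) _ j ∈ Summit.Ventures.HSemireg.WedgeBox.C n 1
  have hj := j.2
  rw [Summit.Ventures.HSemireg.WedgeBox.mem_C]
  simp only [eoff, Fin.val_mk, Fin.isValue, Fin.val_one]
  all_goals omega

/-! #### The adapted generators on the Weil side and the change-of-generators map -/

variable (n)

/-- the basis vector of `x_c` (junk `0` beyond the range). -/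
noncomputable def xv (c : ℕ) : In (n + n) → K := if h : c < n + n then b K (In (n + n)) (xI c h) else 0
/-- the basis vector of `y_c`. -/
noncomputable def yv (c : ℕ) : In (n + n) → K := if h : c < n + n then b K (In (n + n)) (yI c h) else 0

variable {n}

/-- `ι (xv c) = x_c`. -/
lemma ι_xv (c : ℕ) : ExteriorAlgebra.ι K (xv K n c) = X K (n + n) c := by
  by_cases h : c < n + n
  · rw [xv, X, dif_pos h, dif_pos h, gx_eq_ι]
  · rw [xv, X, dif_neg h, dif_neg h, map_zero]

/-- `ι (yv c) = y_c`. -/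
lemma ι_yv (c : ℕ) : ExteriorAlgebra.ι K (yv K n c) = Y K (n + n) c := by
  by_cases h : c < n + n
  · rw [yv, Y, dif_pos h, dif_pos h, gx_eq_ι]
  · rw [yv, Y, dif_neg h, dif_neg h, map_zero]

/-- `ι (xv c + t·yv c) = x_c + t·y_c`. -/
lemma ι_lin (c : ℕ) (t : K) :
    ExteriorAlgebra.ι K (xv K n c + t • yv K n c) = X K (n + n) c + t • Y K (n + n) c := by
  rw [map_add, map_smul, ι_xv, ι_yv]

variable (n)

/-- images of the box generators: `A0 ↦ (x_c + λy_c)_{c≥n}`, `A1 ↦ (x_c + μy_c)_{c<n}`, `C0 ↦ (x_c + λy_c)_{c<n}`,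
`C1 ↦ (x_c + μy_c)_{c≥n}`. -/
noncomputable def img (lam mu : K) (i : Summit.Ventures.HSemireg.WedgeBox.I n) : In (n + n) → K :=
  if (i : ℕ) < n then xv K n (n + i) + lam • yv K n (n + i)
  else if (i : ℕ) < n + n then xv K n (i - n) + mu • yv K n (i - n)
  else if (i : ℕ) < n + n + n then xv K n (i - (n + n)) + lam • yv K n (i - (n + n))
  else xv K n (i - (n + n)) + mu • yv K n (i - (n + n))

/-- the change-of-generators linear map. -/
noncomputable def ψ (lam mu : K) : (Summit.Ventures.HSemireg.WedgeBox.I n → K) →ₗ[K] (In (n + n) → K) :=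
  (Summit.Ventures.HSemireg.WedgeBox.b K n).constr K (img K n lam mu)

variable {n}

/-- the change of generators on a box basis vector is the prescribed image `img`. -/
lemma ψ_b (lam mu : K) (i : Summit.Ventures.HSemireg.WedgeBox.I n) : ψ K n lam mu (Summit.Ventures.HSemireg.WedgeBox.b K n i) = img K n lam mu i :=
  Basis.constr_basis _ _ _ _

/-- the image of the `j`-th generator of block `A 0` is `x_{n+j} + λ·y_{n+j}`. -/
lemma img_A0 (lam mu : K) (j : Fin n) :
    img K n lam mu (eoff n 0 (by omega) j) = xv K n (n + j) + lam • yv K n (n + j) := by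
  have hj := j.2
  simp only [img, eoff, Nat.zero_add]
  rw [if_pos hj]

/-- the image of the `j`-th generator of block `A 1` is `x_j + μ·y_j`. -/
lemma img_A1 (lam mu : K) (j : Fin n) :
    img K n lam mu (eoff n n (by omega) j) = xv K n j + mu • yv K n j := by
  have hj := j.2
  simp only [img, eoff]
  rw [if_neg (by omega), if_pos (by omega), Nat.add_sub_cancel_left]

/-- the image of the `j`-th generator of block `C 0` is `x_j + λ·y_j`. -/
lemma img_C0 (lam mu : K) (j : Fin n) :
    img K n lam mu (eoff n (n + n) (by omega) j) = xv K n j + lam • yv K n j := by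
  have hj := j.2
  simp only [img, eoff]
  rw [if_neg (by omega), if_neg (by omega), if_pos (by omega), Nat.add_sub_cancel_left]

/-- the image of the `j`-th generator of block `C 1` is `x_{n+j} + μ·y_{n+j}`. -/
lemma img_C1 (lam mu : K) (j : Fin n) :
    img K n lam mu (eoff n (n + n + n) (by omega) j) = xv K n (n + j) + mu • yv K n (n + j) := by
  have hj := j.2
  simp only [img, eoff]
  rw [if_neg (by omega), if_neg (by omega), if_neg (by omega),
    show n + n + n + (j : ℕ) - (n + n) = n + j by omega]

/-! #### `ψ` is a linear equivalence when `λ ≠ μ` -/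

/-- the standard basis vector at the index `x_c` is `xv c`. -/
lemma b_xJ_eq_xv (c : Fin (n + n)) : b K (In (n + n)) (xJ (n + n) c) = xv K n c := by
  rw [xv, dif_pos c.2, xI_eq_xJ]

/-- the standard basis vector at the index `y_c` is `yv c`. -/
lemma b_yJ_eq_yv (c : Fin (n + n)) : b K (In (n + n)) (yJ (n + n) c) = yv K n c := by
  rw [yv, dif_pos c.2, yI_eq_yJ]

/-- `xv c` and `yv c` lie in the range of the change of generators (`λ ≠ μ`). -/
lemma xv_mem_range (lam mu : K) (hlm : lam ≠ mu) (c : Fin (n + n)) :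
    xv K n c ∈ LinearMap.range (ψ K n lam mu) ∧ yv K n c ∈ LinearMap.range (ψ K n lam mu) := by
  have hml : mu - lam ≠ 0 := sub_ne_zero.mpr (Ne.symm hlm)
  -- two images whose span contains x_c and y_c
  have key : ∀ (P Q : In (n + n) → K), P = xv K n c + lam • yv K n c → Q = xv K n c + mu • yv K n c →
      P ∈ LinearMap.range (ψ K n lam mu) → Q ∈ LinearMap.range (ψ K n lam mu) →
      xv K n c ∈ LinearMap.range (ψ K n lam mu) ∧ yv K n c ∈ LinearMap.range (ψ K n lam mu) := by
    intro P Q hP hQ hPr hQr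
    have hx : xv K n c = (mu - lam)⁻¹ • (mu • P - lam • Q) := by
      rw [hP, hQ, smul_add, smul_add, smul_smul, smul_smul, mul_comm mu lam, add_sub_add_right_eq_sub,
        ← sub_smul, smul_smul, inv_mul_cancel₀ hml, one_smul]
    have hy : yv K n c = (mu - lam)⁻¹ • (Q - P) := by
      rw [hP, hQ, add_sub_add_left_eq_sub, ← sub_smul, smul_smul, inv_mul_cancel₀ hml, one_smul]
    refine ⟨?_, ?_⟩
    · rw [hx]; exact Submodule.smul_mem _ _ (Submodule.sub_mem _ (Submodule.smul_mem _ _ hPr) (Submodule.smul_mem _ _ hQr))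
    · rw [hy]; exact Submodule.smul_mem _ _ (Submodule.sub_mem _ hQr hPr)
  by_cases hc : (c : ℕ) < n
  · -- lower pair: images of C0_c (λ) and A1_c (μ)
    let j : Fin n := ⟨c, hc⟩
    have hC : img K n lam mu (eoff n (n + n) (by omega) j) = xv K n c + lam • yv K n c := img_C0 K lam mu j
    have hA : img K n lam mu (eoff n n (by omega) j) = xv K n c + mu • yv K n c := img_A1 K lam mu j
    exact key _ _ hC hA ⟨_, ψ_b K lam mu _⟩ ⟨_, ψ_b K lam mu _⟩
  · -- upper pair: images of A0_j (λ) and C1_j (μ), j = c - n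
    have hj : (c : ℕ) - n < n := by have := c.2; omega
    let j : Fin n := ⟨c - n, hj⟩
    have hnj : n + (j : ℕ) = c := by show n + (c - n) = c; omega
    have hA : img K n lam mu (eoff n 0 (by omega) j) = xv K n c + lam • yv K n c := by rw [img_A0, hnj]
    have hC : img K n lam mu (eoff n (n + n + n) (by omega) j) = xv K n c + mu • yv K n c := by rw [img_C1, hnj]
    exact key _ _ hA hC ⟨_, ψ_b K lam mu _⟩ ⟨_, ψ_b K lam mu _⟩

/-- the change of generators is surjective (`λ ≠ μ`). -/
lemma range_ψ (lam mu : K) (hlm : lam ≠ mu) : LinearMap.range (ψ K n lam mu) = ⊤ := by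
  rw [eq_top_iff, ← (b K (In (n + n))).span_eq, Submodule.span_le]
  rintro _ ⟨k, rfl⟩
  rcases eq_xJ_or_eq_yJ k with hk | hk
  · rw [hk, SetLike.mem_coe, b_xJ_eq_xv]; exact (xv_mem_range K lam mu hlm _).1
  · rw [hk, SetLike.mem_coe, b_yJ_eq_yv]; exact (xv_mem_range K lam mu hlm _).2

/-- the change of generators is bijective (`λ ≠ μ`; surjective between spaces of equal dimension). -/
lemma ψ_bijective (lam mu : K) (hlm : lam ≠ mu) : Function.Bijective (ψ K n lam mu) := by
  have hsurj : Function.Surjective (ψ K n lam mu) := LinearMap.range_eq_top.mp (range_ψ K lam mu hlm)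
  refine ⟨?_, hsurj⟩
  have hdim : Module.finrank K (Summit.Ventures.HSemireg.WedgeBox.I n → K) = Module.finrank K (In (n + n) → K) := by
    rw [Module.finrank_fintype_fun_eq_card, Module.finrank_fintype_fun_eq_card, Fintype.card_fin, Fintype.card_fin]
    omega
  exact (LinearMap.injective_iff_surjective_of_finrank_eq_finrank hdim).mpr hsurj

variable (n)

/-- the change of generators as a linear equivalence. -/
noncomputable def ψE (lam mu : K) (hlm : lam ≠ mu) : (Summit.Ventures.HSemireg.WedgeBox.I n → K) ≃ₗ[K] (In (n + n) → K) :=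
  LinearEquiv.ofBijective (ψ K n lam mu) (ψ_bijective K lam mu hlm)

/-- … as an isometry of the ZERO quadratic forms. -/
noncomputable def isoQ (lam mu : K) (hlm : lam ≠ mu) :
    (0 : QuadraticForm K (Summit.Ventures.HSemireg.WedgeBox.I n → K)).IsometryEquiv (0 : QuadraticForm K (In (n + n) → K)) :=
  { ψE K n lam mu hlm with map_app' := fun m => by simp }

/-- the induced isomorphism of exterior algebras (box model → Weil model). -/
noncomputable def Φ (lam mu : K) (hlm : lam ≠ mu) : Summit.Ventures.HSemireg.WedgeBox.HT K n ≃ₐ[K] HT K (In (n + n)) :=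
  CliffordAlgebra.equivOfIsometry (isoQ K n lam mu hlm)

variable {n}

/-- `Φ` on generators is `eN`. -/
lemma Φ_ι (lam mu : K) (hlm : lam ≠ mu) (m : Summit.Ventures.HSemireg.WedgeBox.I n → K) :
    Φ K n lam mu hlm (ExteriorAlgebra.ι K m) = ExteriorAlgebra.ι K (ψ K n lam mu m) := by
  rw [Φ, CliffordAlgebra.equivOfIsometry_apply]
  show CliffordAlgebra.map _ (CliffordAlgebra.ι _ m) = CliffordAlgebra.ι _ _
  rw [CliffordAlgebra.map_apply_ι]
  rfl

/-- `Φ` maps the generators onto the generators. -/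
lemma map_Φ_range_ι (lam mu : K) (hlm : lam ≠ mu) :
    Submodule.map (Φ K n lam mu hlm).toLinearMap
      (LinearMap.range (ExteriorAlgebra.ι K : (Summit.Ventures.HSemireg.WedgeBox.I n → K) →ₗ[K] _)) =
      LinearMap.range (ExteriorAlgebra.ι K : (In (n + n) → K) →ₗ[K] _) := by
  rw [← LinearMap.range_comp]
  have h : (Φ K n lam mu hlm).toLinearMap ∘ₗ (ExteriorAlgebra.ι K : (Summit.Ventures.HSemireg.WedgeBox.I n → K) →ₗ[K] _) =
      (ExteriorAlgebra.ι K : (In (n + n) → K) →ₗ[K] _) ∘ₗ (ψE K n lam mu hlm).toLinearMap := by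
    refine LinearMap.ext fun m => ?_
    simp only [LinearMap.coe_comp, Function.comp_apply, LinearEquiv.coe_coe]
    exact Φ_ι K lam mu hlm m
  rw [h, LinearMap.range_comp_of_range_eq_top _ (LinearEquiv.range (ψE K n lam mu hlm))]

/-- `Φ` maps `⋀^k` onto `⋀^k`. -/
lemma map_Φ_exteriorPower (lam mu : K) (hlm : lam ≠ mu) (k : ℕ) :
    Submodule.map (Φ K n lam mu hlm).toLinearMap (⋀[K]^k (Summit.Ventures.HSemireg.WedgeBox.I n → K)) = ⋀[K]^k (In (n + n) → K) := by
  show Submodule.map (Φ K n lam mu hlm).toAlgHom.toLinearMap (LinearMap.range (ExteriorAlgebra.ι K) ^ k) =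
    LinearMap.range (ExteriorAlgebra.ι K) ^ k
  rw [Submodule.map_pow, show (Φ K n lam mu hlm).toAlgHom.toLinearMap = (Φ K n lam mu hlm).toLinearMap from rfl,
    map_Φ_range_ι]

/-- the induced isomorphism carries the range of `θ ↦ θ ∧ v` on `⋀^k` to the range of `θ ↦ θ ∧ Φ v`. -/
lemma map_Φ_range_wedgeMap (lam mu : K) (hlm : lam ≠ mu) (k : ℕ) (v : Summit.Ventures.HSemireg.WedgeBox.HT K n) :
    Submodule.map (Φ K n lam mu hlm).toLinearMap (LinearMap.range (Summit.Ventures.HSemireg.WedgeBox.wedgeMap K n k v)) =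
      LinearMap.range (wedge K (n + n) k (Φ K n lam mu hlm v)) := by
  rw [Summit.Ventures.HSemireg.WedgeBox.wedgeMap, wedge, LinearMap.range_comp, LinearMap.range_comp, Submodule.range_subtype,
    Submodule.range_subtype, ← map_Φ_exteriorPower K lam mu hlm k, ← Submodule.map_comp, ← Submodule.map_comp]
  congr 1
  refine LinearMap.ext fun x => ?_
  simp only [LinearMap.coe_comp, Function.comp_apply, LinearMap.mulRight_apply, AlgEquiv.toLinearMap_apply,
    map_mul]

/-- ranks are transported. -/
theorem finrank_range_wedge_Φ (lam mu : K) (hlm : lam ≠ mu) (k : ℕ) (v : Summit.Ventures.HSemireg.WedgeBox.HT K n) :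
    Module.finrank K (LinearMap.range (wedge K (n + n) k (Φ K n lam mu hlm v))) =
      Module.finrank K (LinearMap.range (Summit.Ventures.HSemireg.WedgeBox.wedgeMap K n k v)) := by
  rw [← map_Φ_range_wedgeMap]
  exact LinearEquiv.finrank_map_eq (Φ K n lam mu hlm).toLinearEquiv _

end Summit.Ventures.HSemireg.Wedge.WeilPurity
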